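import Literature.NumberTheory.EllipticCurves.YanZhu2026.GreenbergMainTheorems
import HarnessLib

/-!
# The anticyclotomic Eisenstein crux in SIGNED currency — a kernel-checked census remark for
# `AnticyclotomicEisensteinDivisibility` (stmt-BirchSwinnertonDyer-20727, route SignedBaseChange)

Lead prover sbc-p1 g6 (2026-08-27). The crux's own antecedent `SignedTwoVariableInputs` carries (conjunct 2,
BSTW24 Prop. 1.18 in identity form, (P1) of `props118_27_519_exists_signedTwoVariablePackage_supersingular_PRE`)
the ideal identity `(ξ_∘ · G) = ch(X_Gr(E/K_∞))^ur · (𝓛^∘)` in `𝒪_{ℂ_p}⟦T₁⟧⟦T₂⟧` for SOME signed pair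
`(ξ_∘, 𝓛^∘)`. Applying the ring map `minus = constantCoeff` ("restriction to the anticyclotomic line
`T₁ = 0`") gives `minus(ch^ur) · (𝓛^∘⁻) = (ξ_∘⁻ · G⁻)`; so IF the one-variable SIGNED anticyclotomic
Eisenstein inclusion `𝓛^∘⁻ ∣ ξ_∘⁻` held for that pair and `𝓛^∘⁻ ≠ 0`, cancellation in the domain `𝒪_{ℂ_p}⟦T⟧`
would give the crux's conclusion `minus(ch^ur) ⊆ (G⁻)`. This file PROVES that implication as pure algebra
(`map_constantCoeff_le_span_minus_of_signed`), for ANY `(ξ, 𝓛)` satisfying the (P1)-shaped identity —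
recording why the route did NOT take this road: `ξ_∘, 𝓛^∘` are existentially bound in the antecedent and
not pinned by (P1)–(P3) (no typed two-variable signed carriers, HOME/bsd-wall-ss/TYPING-BRIEF-2VAR-SIGNED),
so the signed anticyclotomic lower bound cannot be stated about them; and its content at a supersingular
prime with additive conductor is the same kernel (G2″) as stub S1-ss of line `bdpline`. Nothing asserted;
no new definitions.
-/

-- D-0017: single-problem summit, the namespace repeats the problem name by design.
set_option linter.dupNamespace false
set_option autoImplicit false

noncomputable section

namespace Summit.BirchSwinnertonDyer.BirchSwinnertonDyer.Theorems.SignedBaseChangeAcDivSignedAnchor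

open Literature.NumberTheory.EllipticCurves Literature.NumberTheory.EllipticCurves.UnrSeries₂

variable {p : ℕ} [Fact p.Prime]

/-- **Signed anchor on the anticyclotomic line (pure algebra).** In `𝒪_{ℂ_p}⟦T₁⟧⟦T₂⟧`, from the
(P1)-shaped identity `(ξ · G) = I · (𝓛)` (BSTW24 Prop. 1.18 identity form, `I = ch(X_Gr)^ur`), a
one-variable signed anticyclotomic lower bound `minus 𝓛 ∣ minus ξ` and `minus 𝓛 ≠ 0`, the crux's
conclusion `I.map constantCoeff ≤ (minus G)` follows: apply the ring map `minus = constantCoeff`, then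
cancel `minus 𝓛` in the domain `𝒪_{ℂ_p}⟦T⟧`.
[cite: BurungaleSkinnerTianWan2024, Prop. 1.18 (Part III §1.3.2, identity form; arXiv:2409.01350v2 TeX store p0072 L1–L21) (shape only; nothing asserted)] -/
theorem map_constantCoeff_le_span_minus_of_signed
    (I : Ideal (PowerSeries (PowerSeries (PadicComplexInt p))))
    (xi G Lsig : PowerSeries (PowerSeries (PadicComplexInt p)))
    (hP1 : Ideal.span {xi * G} = I * Ideal.span {Lsig})
    (hlow : minus Lsig ∣ minus xi) (hne : minus Lsig ≠ 0) :
    I.map (PowerSeries.constantCoeff (R := PowerSeries (PadicComplexInt p))) ≤ Ideal.span {minus G} := by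
  -- apply `minus` (= the outer `constantCoeff`, a ring map) to the identity
  have hmap := congrArg (Ideal.map (PowerSeries.constantCoeff (R := PowerSeries (PadicComplexInt p)))) hP1
  rw [Ideal.map_span, Set.image_singleton, Ideal.map_mul, Ideal.map_span _ {Lsig}, Set.image_singleton]
    at hmap
  -- `hmap : span {minus (ξ G)} = I⁻ * span {minus 𝓛}`
  intro y hy
  have hyL : y * minus Lsig ∈ Ideal.span {minus (xi * G)} := by
    change y * minus Lsig ∈ Ideal.span {PowerSeries.constantCoeff (R := PowerSeries (PadicComplexInt p)) (xi * G)}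
    rw [hmap]
    exact Ideal.mul_mem_mul hy (Ideal.mem_span_singleton_self _)
  rw [minus_mul] at hyL
  obtain ⟨c, hc⟩ := Ideal.mem_span_singleton.mp hyL
  obtain ⟨d, hd⟩ := hlow
  -- `y · 𝓛⁻ = ξ⁻ G⁻ c = 𝓛⁻ d G⁻ c`; cancel `𝓛⁻`
  refine Ideal.mem_span_singleton.mpr ⟨d * c, ?_⟩
  have h : minus Lsig * y = minus Lsig * (minus G * (d * c)) := by
    rw [mul_comm (minus Lsig) y, hc, hd]; ring
  exact mul_left_cancel₀ hne h

end Summit.BirchSwinnertonDyer.BirchSwinnertonDyer.Theorems.SignedBaseChangeAcDivSignedAnchor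

end
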